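import Literature.Computability.Cryptography.PolyTimeComputableGramSchmidt
import Literature.Computability.Cryptography.QuantumTuringMachineUnidirectional
import HarnessLib

/-!
# Bernstein–Vazirani's unidirection lemma (SIAM J. Comput. 26 (1997), Lemma 5.5) in the positioned model, inside `C̃`

**Lemma 5.5 (unidirection lemma).** "Any QTM `M` is simulated, with slowdown by a factor of
`5`, by a unidirectional QTM `M'`." This file proves it for Bernstein–Vazirani's own
(positioned) model of the tree (`Cryptography/QuantumTuringMachinePositioned.lean`), keeping the
amplitudes polynomial-time computable (BV Def. 3.2, the class `C̃`), in the form used by the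
circuit simulation of quantum Turing machines (`QuantumComplexity/QuantumTuringYao.lean`,
hypothesis `hUni` of `BQPQTMPos_subset_BQP_of_unidirection_of_SK`):

* `QTM.unidir M b tag` — the machine `M'` of BV's proof (p. 1436): state set `Q × {0,1,2,3,4}`,
  five interleaved transition functions (Lemma 5.4) — step right; change basis from `Q` to an
  orthonormal basis `b` of `ℂ^Q` while stepping left; one step of `M` in the basis `b`
  (`δ'(v,σ,τ,v',d) = ∑_{p,q} ⟨v|p⟩⟨q|v'⟩ δ(p,σ,τ,q,d)`, Lemma 5.1); change basis back while
  stepping left; step right — for a basis `b` ADAPTED to the direction spaces: every `b i` lies in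
  `C_R = span{δ(p,σ|τ,R)}` or in `C_Rᗮ ⊇ C_L` (separability), the tag `tag i` recording which;
* `unidir_isUnidirectionalWith` — `M'` is unidirectional (states `(i, 3)` are entered only in
  direction `tag i`, all other states in a fixed direction);
* `unidir_isLocallyWellFormed`, `unidir_pIsWellFormed` — `M'` is well formed (BV Thm. 5.3: unit
  length and orthogonality from those of `M` and Parseval for `b`; separability is trivial for a
  unidirectional table);
* `unidir_amplitudes_subset` — the amplitudes of `M'` are in `C̃` when those of `M` and the
  coordinates of `b` are;
* `pevolve_add'`, `pevolve_smul'`, `pevolveLin` — the positioned evolution as a `ℂ`-linear map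
  (bookkeeping for the simulation).

The SIMULATION half of Lemma 5.5 (five steps of `M'` on `|(p,0), T, ξ⟩` are one step of `M`
relabelled, hence `pacceptProbAt M' x (5t) = pacceptProbAt M x t`, and the packaged statement
with the basis from `exists_orthonormal_adapted_polyTime`) is the subject of the sequel file.
No named facts.

## References

* E. Bernstein, U. Vazirani, *Quantum complexity theory*, SIAM J. Comput. 26 (1997) 1411–1473
  [BernsteinVaziraniSICOMP1997]: Def. 3.2, Def. 3.14, §5.1 Lemma 5.1, Thm. 5.3, Lemma 5.4,
  Lemma 5.5 and its proof (pp. 1435–1436).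
-/

noncomputable section

namespace Literature.Computability.Cryptography

namespace QTM

open Turing Finsupp
open scoped BigOperators ComplexConjugate InnerProductSpace

variable (M : QTM)

/-! ### The restricted superpositions as vectors, and adapted bases -/

/-- The restricted superposition `δ(p, σ | τ, d) = ∑_q δ(p,σ,q,τ,d) |q⟩` as a vector of `ℂ^Q`
(Bernstein–Vazirani 1997, Def. 5.2). [cite: BernsteinVaziraniSICOMP1997, Def. 5.2] -/
def rvec (p : M.Λ) (σ τ : M.Γ) (d : Dir) : EuclideanSpace ℂ M.Λ :=
  WithLp.toLp 2 fun q => M.δ p σ q τ d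

/-- Coordinates of `rvec`. [folklore] -/
@[simp] theorem rvec_apply (p : M.Λ) (σ τ : M.Γ) (d : Dir) (q : M.Λ) : M.rvec p σ τ d q = M.δ p σ q τ d := rfl

/-- The right-going restricted superpositions, as a family. [cite: BernsteinVaziraniSICOMP1997, Def. 5.2] -/
def rvecR (k : M.Λ × M.Γ × M.Γ) : EuclideanSpace ℂ M.Λ := M.rvec k.1 k.2.1 k.2.2 Dir.right

/-- The space `C_R` spanned by the right-going restricted superpositions
(Bernstein–Vazirani 1997, proof of Lemma 5.5). [cite: BernsteinVaziraniSICOMP1997, Lemma 5.5 (proof)] -/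
def spaceR : Submodule ℂ (EuclideanSpace ℂ M.Λ) := Submodule.span ℂ (Set.range M.rvecR)

/-- **An adapted basis**: an orthonormal basis `b` of `ℂ^Q` indexed by `Q` together with tags
such that `b i ∈ C_R` when `tag i = R` and `b i ∈ C_Rᗮ` when `tag i = L`
(Bernstein–Vazirani 1997, proof of Lemma 5.5: `B = B_L ∪ B_R`). [cite: BernsteinVaziraniSICOMP1997, Lemma 5.5 (proof)] -/
structure AdaptedBasis where
  /-- the basis vectors -/
  b : OrthonormalBasis M.Λ ℂ (EuclideanSpace ℂ M.Λ)
  /-- the direction tag of each basis vector -/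
  tag : M.Λ → Dir
  mem_of_right : ∀ i, tag i = Dir.right → b i ∈ M.spaceR
  mem_of_left : ∀ i, tag i = Dir.left → b i ∈ M.spaceRᗮ

variable {M}

/-- Right-going restricted superpositions lie in `C_R`. [folklore] -/
theorem rvec_right_mem_spaceR (p : M.Λ) (σ τ : M.Γ) : M.rvec p σ τ Dir.right ∈ M.spaceR :=
  Submodule.subset_span ⟨(p, σ, τ), rfl⟩

/-- **Separability puts the left-going restricted superpositions into `C_Rᗮ`**
(Bernstein–Vazirani 1997, Thm. 5.3, separability: `δ(p₁,σ₁|τ₁,L) · δ(p₂,σ₂|τ₂,R) = 0`). [cite: BernsteinVaziraniSICOMP1997, Lemma 5.5 (proof)] -/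
theorem rvec_left_mem_spaceR_orthogonal (h : M.IsLocallyWellFormed) (p : M.Λ) (σ τ : M.Γ) :
    M.rvec p σ τ Dir.left ∈ M.spaceRᗮ := by
  refine mem_orthogonal_span_of_forall fun u hu => ?_
  obtain ⟨⟨p₂, σ₂, τ₂⟩, rfl⟩ := hu
  have hsep := h.separability p σ τ p₂ σ₂ τ₂
  unfold restrictedInner at hsep
  rw [PiLp.inner_apply]
  simp only [rvecR, rvec_apply, RCLike.inner_apply]
  exact hsep

/-- For an adapted basis, `⟪b i, δ(p,σ|τ,d)⟫ = 0` unless `d = tag i`. [cite: BernsteinVaziraniSICOMP1997, Lemma 5.5 (proof)] -/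
theorem AdaptedBasis.inner_rvec_eq_zero (B : M.AdaptedBasis) (h : M.IsLocallyWellFormed) (i : M.Λ) (p : M.Λ) (σ τ : M.Γ)
    {d : Dir} (hd : d ≠ B.tag i) : ⟪(B.b i : EuclideanSpace ℂ M.Λ), M.rvec p σ τ d⟫_ℂ = 0 := by
  cases d with
  | left =>
    have ht : B.tag i = Dir.right := by cases h' : B.tag i <;> simp_all
    exact Submodule.inner_right_of_mem_orthogonal (B.mem_of_right i ht) (rvec_left_mem_spaceR_orthogonal h p σ τ)
  | right =>
    have ht : B.tag i = Dir.left := by cases h' : B.tag i <;> simp_all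
    exact Submodule.inner_left_of_mem_orthogonal (rvec_right_mem_spaceR p σ τ) (B.mem_of_left i ht)

/-! ### The machine `M'` -/

/-- The transition function of `M` in the basis `b` (Bernstein–Vazirani 1997, Lemma 5.1):
`δ'(v,σ,τ,v',d) = ∑_{p,q} ⟨v|p⟩⟨q|v'⟩ δ(p,σ,τ,q,d) = ∑_p v_p ⟪v', δ(p,σ|τ,d)⟫`. [cite: BernsteinVaziraniSICOMP1997, Lemma 5.1] -/
def deltaB (B : M.AdaptedBasis) (i : M.Λ) (σ : M.Γ) (j : M.Λ) (τ : M.Γ) (d : Dir) : ℂ :=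
  ∑ p : M.Λ, (B.b i : EuclideanSpace ℂ M.Λ) p * ⟪(B.b j : EuclideanSpace ℂ M.Λ), M.rvec p σ τ d⟫_ℂ

/-- **The five phase amplitudes** of Bernstein–Vazirani's machine (p. 1436), from phase `k` to
phase `k'` (non-zero only for `k' = k + 1 mod 5`): (0→1) step right; (1→2)
`|p⟩ ↦ ∑_i ⟨p|b_i⟩ |i⟩` stepping left; (2→3) one step of `M` in the basis `b` (`deltaB`); (3→4)
`|j⟩ ↦ ∑_p ⟨b_j|p⟩ |p⟩` stepping left; (4→0) step right. [cite: BernsteinVaziraniSICOMP1997, Lemma 5.5 (proof)] -/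
def phaseAmp (B : M.AdaptedBasis) (k k' : Fin 5) (p : M.Λ) (σ : M.Γ) (q : M.Λ) (τ : M.Γ) (d : Dir) : ℂ :=
  if k = 0 ∧ k' = 1 then (if q = p ∧ τ = σ ∧ d = Dir.right then 1 else 0)
  else if k = 1 ∧ k' = 2 then (if τ = σ ∧ d = Dir.left then conj ((B.b q : EuclideanSpace ℂ M.Λ) p) else 0)
  else if k = 2 ∧ k' = 3 then deltaB B p σ q τ d
  else if k = 3 ∧ k' = 4 then (if τ = σ ∧ d = Dir.left then (B.b p : EuclideanSpace ℂ M.Λ) q else 0)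
  else if k = 4 ∧ k' = 0 then (if q = p ∧ τ = σ ∧ d = Dir.right then 1 else 0)
  else 0

variable (M) in
/-- **The unidirectional machine `M'` of Bernstein–Vazirani's Lemma 5.5** (p. 1436): states
`Q × Fin 5` (the phase), transition amplitudes `phaseAmp`, start and accepting states those of
`M` in phase `0`. [cite: BernsteinVaziraniSICOMP1997, Lemma 5.5 (proof)] -/
def unidir (B : M.AdaptedBasis) : QTM where
  Λ := M.Λ × Fin 5
  Γ := M.Γ
  start := (M.start, 0)
  accept := (M.accept, 0)
  embed := M.embed
  δ := fun x σ y τ d => phaseAmp B x.2 y.2 x.1 σ y.1 τ d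

/-- The transition amplitudes of `M'` (definitional). [folklore] -/
@[simp] theorem unidir_δ (B : M.AdaptedBasis) (x : M.Λ × Fin 5) (σ : M.Γ) (y : M.Λ × Fin 5) (τ : M.Γ) (d : Dir) :
    (M.unidir B).δ x σ y τ d = phaseAmp B x.2 y.2 x.1 σ y.1 τ d := rfl

/-- The direction assignment of `M'`: phase-`3` states `(i, 3)` are entered in direction
`tag i`, phases `1, 0` after a right move, phases `2, 4` after a left move. [cite: BernsteinVaziraniSICOMP1997, Lemma 5.5 (proof)] -/
def unidirDir (B : M.AdaptedBasis) (y : M.Λ × Fin 5) : Dir :=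
  if y.2 = 0 then Dir.right else if y.2 = 1 then Dir.right else if y.2 = 2 then Dir.left
  else if y.2 = 3 then B.tag y.1 else Dir.left

/-- `deltaB` vanishes against the tag (the adaptedness of the basis). [cite: BernsteinVaziraniSICOMP1997, Lemma 5.5 (proof)] -/
theorem deltaB_eq_zero_of_ne (B : M.AdaptedBasis) (h : M.IsLocallyWellFormed) (i : M.Λ) (σ : M.Γ) (j : M.Λ)
    (τ : M.Γ) {d : Dir} (hd : d ≠ B.tag j) : deltaB B i σ j τ d = 0 := by
  unfold deltaB
  exact Finset.sum_eq_zero fun p _ => by rw [B.inner_rvec_eq_zero h j p σ τ hd, mul_zero]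

/-- **Non-zero amplitudes of `M'` respect the direction assignment.** [cite: BernsteinVaziraniSICOMP1997, Lemma 5.5 (proof)] -/
theorem eq_unidirDir_of_phaseAmp_ne_zero (B : M.AdaptedBasis) (h : M.IsLocallyWellFormed) {k k' : Fin 5} {p : M.Λ}
    {σ : M.Γ} {q : M.Λ} {τ : M.Γ} {d : Dir} (hne : phaseAmp B k k' p σ q τ d ≠ 0) : d = unidirDir B (q, k') := by
  unfold phaseAmp at hne
  split_ifs at hne with h1 h1' h2 h2' h3 h4 h4' h5 h5'
  all_goals first
    | exact absurd rfl hne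
    | skip
  · obtain ⟨-, rfl⟩ := h1
    obtain ⟨-, -, rfl⟩ := h1'
    simp [unidirDir]
  · obtain ⟨-, rfl⟩ := h2
    obtain ⟨-, rfl⟩ := h2'
    simp [unidirDir]
  · obtain ⟨-, rfl⟩ := h3
    by_contra hd
    exact hne (deltaB_eq_zero_of_ne B h p σ q τ (by simpa [unidirDir] using hd))
  · obtain ⟨-, rfl⟩ := h4
    obtain ⟨-, rfl⟩ := h4'
    simp [unidirDir]
  · obtain ⟨-, rfl⟩ := h5
    obtain ⟨-, -, rfl⟩ := h5'
    simp [unidirDir]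

/-- **`M'` is unidirectional.** [cite: BernsteinVaziraniSICOMP1997, Lemma 5.5] -/
theorem unidir_isUnidirectionalWith (B : M.AdaptedBasis) (h : M.IsLocallyWellFormed) :
    (M.unidir B).IsUnidirectionalWith (unidirDir B) := by
  intro x σ y τ d hd
  by_contra hne
  exact hd (eq_unidirDir_of_phaseAmp_ne_zero B h hne)

/-! ### Basis identities (Parseval) -/

section Parseval

variable (B : M.AdaptedBasis)

/-- `∑_i conj(b_i p₁) b_i p₂ = [p₁ = p₂]` (the rows of the unitary `(b_i p)_{p,i}` are orthonormal). [folklore] -/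
theorem AdaptedBasis.sum_conj_mul (p₁ p₂ : M.Λ) :
    ∑ i, conj ((B.b i : EuclideanSpace ℂ M.Λ) p₁) * (B.b i : EuclideanSpace ℂ M.Λ) p₂ = if p₁ = p₂ then 1 else 0 := by
  classical
  have h := B.b.sum_inner_mul_inner (EuclideanSpace.single p₂ (1 : ℂ)) (EuclideanSpace.single p₁ (1 : ℂ))
  simp only [EuclideanSpace.inner_single_left, EuclideanSpace.inner_single_right, map_one, one_mul] at h
  rw [EuclideanSpace.single, PiLp.single_apply] at h
  rw [show (∑ i, conj ((B.b i : EuclideanSpace ℂ M.Λ) p₁) * (B.b i : EuclideanSpace ℂ M.Λ) p₂) =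
      ∑ i, (B.b i : EuclideanSpace ℂ M.Λ) p₂ * conj ((B.b i : EuclideanSpace ℂ M.Λ) p₁) from
    Finset.sum_congr rfl fun i _ => mul_comm _ _, h]
  by_cases hp : p₁ = p₂ <;> simp [hp]

/-- `∑_q b_{j₁} q conj(b_{j₂} q) = [j₁ = j₂]` (orthonormality). [folklore] -/
theorem AdaptedBasis.sum_mul_conj (j₁ j₂ : M.Λ) :
    ∑ q, (B.b j₁ : EuclideanSpace ℂ M.Λ) q * conj ((B.b j₂ : EuclideanSpace ℂ M.Λ) q) = if j₁ = j₂ then 1 else 0 := by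
  have h := B.b.orthonormal
  rw [orthonormal_iff_ite] at h
  have := h j₂ j₁
  rw [PiLp.inner_apply] at this
  simp only [RCLike.inner_apply] at this
  rw [this]
  by_cases hj : j₁ = j₂
  · subst hj; simp
  · rw [if_neg (Ne.symm hj), if_neg hj]

/-- Parseval against a restricted superposition: `∑_j ⟪b_j, r⟫ b_j p' = r p'`. [folklore] -/
theorem AdaptedBasis.sum_inner_mul_apply (v : EuclideanSpace ℂ M.Λ) (p' : M.Λ) :
    ∑ j, ⟪(B.b j : EuclideanSpace ℂ M.Λ), v⟫_ℂ * (B.b j : EuclideanSpace ℂ M.Λ) p' = v p' := by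
  classical
  have h := B.b.sum_inner_mul_inner (EuclideanSpace.single p' (1 : ℂ)) v
  simp only [EuclideanSpace.inner_single_left, map_one, one_mul] at h
  rw [← h]
  exact Finset.sum_congr rfl fun j _ => mul_comm _ _

/-- Parseval: `∑_j ⟪b_j, u⟫ conj ⟪b_j, v⟫ = ⟪v, u⟫`. [folklore] -/
theorem AdaptedBasis.sum_inner_mul_conj_inner (u v : EuclideanSpace ℂ M.Λ) :
    ∑ j, ⟪(B.b j : EuclideanSpace ℂ M.Λ), u⟫_ℂ * conj ⟪(B.b j : EuclideanSpace ℂ M.Λ), v⟫_ℂ = ⟪v, u⟫_ℂ := by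
  rw [← B.b.sum_inner_mul_inner v u]
  exact Finset.sum_congr rfl fun j _ => by rw [inner_conj_symm, mul_comm]

end Parseval

/-! ### Local well-formedness of `M'` -/

section LocalWF

variable (B : M.AdaptedBasis)

/-- Amplitudes vanish unless the phase advances by one. [folklore] -/
theorem phaseAmp_eq_zero_of_ne {k k' : Fin 5} (hk : k' ≠ k + 1) (p : M.Λ) (σ : M.Γ) (q : M.Λ) (τ : M.Γ) (d : Dir) :
    phaseAmp B k k' p σ q τ d = 0 := by
  unfold phaseAmp
  have h0 : ¬(k = 0 ∧ k' = 1) := fun h => hk (by rw [h.1, h.2]; rfl)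
  have h1 : ¬(k = 1 ∧ k' = 2) := fun h => hk (by rw [h.1, h.2]; rfl)
  have h2 : ¬(k = 2 ∧ k' = 3) := fun h => hk (by rw [h.1, h.2]; rfl)
  have h3 : ¬(k = 3 ∧ k' = 4) := fun h => hk (by rw [h.1, h.2]; rfl)
  have h4 : ¬(k = 4 ∧ k' = 0) := fun h => hk (by rw [h.1, h.2]; rfl)
  rw [if_neg h0, if_neg h1, if_neg h2, if_neg h3, if_neg h4]

/-- Phase `0 → 1`. [folklore] -/
theorem phaseAmp_zero (p : M.Λ) (σ : M.Γ) (q : M.Λ) (τ : M.Γ) (d : Dir) :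
    phaseAmp B 0 1 p σ q τ d = if q = p ∧ τ = σ ∧ d = Dir.right then 1 else 0 := by
  simp [phaseAmp]
/-- Phase `1 → 2`. [folklore] -/
theorem phaseAmp_one (p : M.Λ) (σ : M.Γ) (q : M.Λ) (τ : M.Γ) (d : Dir) :
    phaseAmp B 1 2 p σ q τ d = if τ = σ ∧ d = Dir.left then conj ((B.b q : EuclideanSpace ℂ M.Λ) p) else 0 := by
  simp [phaseAmp]
/-- Phase `2 → 3`. [folklore] -/
theorem phaseAmp_two (p : M.Λ) (σ : M.Γ) (q : M.Λ) (τ : M.Γ) (d : Dir) :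
    phaseAmp B 2 3 p σ q τ d = deltaB B p σ q τ d := by
  simp [phaseAmp]
/-- Phase `3 → 4`. [folklore] -/
theorem phaseAmp_three (p : M.Λ) (σ : M.Γ) (q : M.Λ) (τ : M.Γ) (d : Dir) :
    phaseAmp B 3 4 p σ q τ d = if τ = σ ∧ d = Dir.left then (B.b p : EuclideanSpace ℂ M.Λ) q else 0 := by
  simp [phaseAmp]
/-- Phase `4 → 0`. [folklore] -/
theorem phaseAmp_four (p : M.Λ) (σ : M.Γ) (q : M.Λ) (τ : M.Γ) (d : Dir) :
    phaseAmp B 4 0 p σ q τ d = if q = p ∧ τ = σ ∧ d = Dir.right then 1 else 0 := by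
  simp [phaseAmp]

/-- The column inner product of the phase pair `(k, k')`:
`∑_{q,τ,d} A_{k,k'}(p₁,σ₁,q,τ,d) conj A_{k,k'}(p₂,σ₂,q,τ,d)`. [folklore] -/
def colInner (k k' : Fin 5) (p₁ : M.Λ) (σ₁ : M.Γ) (p₂ : M.Λ) (σ₂ : M.Γ) : ℂ :=
  ∑ q : M.Λ, ∑ τ : M.Γ, (phaseAmp B k k' p₁ σ₁ q τ Dir.left * conj (phaseAmp B k k' p₂ σ₂ q τ Dir.left) +
    phaseAmp B k k' p₁ σ₁ q τ Dir.right * conj (phaseAmp B k k' p₂ σ₂ q τ Dir.right))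

/-- The column inner products of `M`: `δ(p₁,σ₁) · δ(p₂,σ₂) = [(p₁,σ₁) = (p₂,σ₂)]` from unit length and
orthogonality. [cite: BernsteinVaziraniSICOMP1997, Thm. 5.3] -/
theorem updateInner_eq_ite (h : M.IsLocallyWellFormed) (p₁ : M.Λ) (σ₁ : M.Γ) (p₂ : M.Λ) (σ₂ : M.Γ) :
    M.updateInner p₁ σ₁ p₂ σ₂ = if p₁ = p₂ ∧ σ₁ = σ₂ then 1 else 0 := by
  split_ifs with hp
  · obtain ⟨rfl, rfl⟩ := hp
    rw [updateInner_self, h.unit_length, Complex.ofReal_one]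
  · exact h.orthogonality _ _ _ _ fun e => hp ⟨(Prod.mk.inj e).1, (Prod.mk.inj e).2⟩

/-- Symmetry of the Kronecker delta on pairs. [folklore] -/
theorem ite_pair_comm (p₁ p₂ : M.Λ) (σ₁ σ₂ : M.Γ) :
    (if p₂ = p₁ ∧ σ₂ = σ₁ then (1 : ℂ) else 0) = if p₁ = p₂ ∧ σ₁ = σ₂ then 1 else 0 := by
  congr 1
  exact propext ⟨fun ⟨a, b⟩ => ⟨a.symm, b.symm⟩, fun ⟨a, b⟩ => ⟨a.symm, b.symm⟩⟩

/-- A deterministic right step has orthonormal columns (phases `0` and `4`). [folklore] -/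
theorem colInner_of_detRight {k k' : Fin 5}
    (hA : ∀ (p : M.Λ) (σ : M.Γ) (q : M.Λ) (τ : M.Γ) (d : Dir),
      phaseAmp B k k' p σ q τ d = if q = p ∧ τ = σ ∧ d = Dir.right then 1 else 0)
    (p₁ : M.Λ) (σ₁ : M.Γ) (p₂ : M.Λ) (σ₂ : M.Γ) :
    colInner B k k' p₁ σ₁ p₂ σ₂ = if p₁ = p₂ ∧ σ₁ = σ₂ then 1 else 0 := by
  unfold colInner
  simp only [hA, reduceCtorEq, and_false, if_false, mul_zero, zero_add, and_true, apply_ite (starRingEnd ℂ), map_one,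
    map_zero, mul_ite, mul_one, ite_and]
  rw [Finset.sum_comm]
  simp only [Finset.sum_ite_eq', Finset.mem_univ, if_true]
  rw [← ite_and, ← ite_and, ite_pair_comm]

/-- A change of basis stepping left has orthonormal columns (phases `1` and `3`). [folklore] -/
theorem colInner_of_basis {k k' : Fin 5} (c : M.Λ → M.Λ → ℂ)
    (hc : ∀ p₁ p₂ : M.Λ, ∑ q, c p₁ q * conj (c p₂ q) = if p₁ = p₂ then 1 else 0)
    (hA : ∀ (p : M.Λ) (σ : M.Γ) (q : M.Λ) (τ : M.Γ) (d : Dir),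
      phaseAmp B k k' p σ q τ d = if τ = σ ∧ d = Dir.left then c p q else 0)
    (p₁ : M.Λ) (σ₁ : M.Γ) (p₂ : M.Λ) (σ₂ : M.Γ) :
    colInner B k k' p₁ σ₁ p₂ σ₂ = if p₁ = p₂ ∧ σ₁ = σ₂ then 1 else 0 := by
  unfold colInner
  simp only [hA, reduceCtorEq, and_false, if_false, mul_zero, add_zero, and_true, apply_ite (starRingEnd ℂ), map_zero,
    mul_ite, ite_mul, zero_mul, Finset.sum_ite_eq', Finset.mem_univ, if_true]
  by_cases hs : σ₁ = σ₂
  · subst hs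
    simp [hc p₁ p₂]
  · have hs' : ¬σ₂ = σ₁ := fun e => hs e.symm
    simp [hs, hs']

/-- **Phase `2` is a change of basis of `M`'s step**: its column inner products are those of `M`
(Bernstein–Vazirani 1997, Lemma 5.1; two applications of Parseval). [cite: BernsteinVaziraniSICOMP1997, Lemma 5.1] -/
theorem colInner_two (h : M.IsLocallyWellFormed) (i₁ : M.Λ) (σ₁ : M.Γ) (i₂ : M.Λ) (σ₂ : M.Γ) :
    colInner B 2 3 i₁ σ₁ i₂ σ₂ = if i₁ = i₂ ∧ σ₁ = σ₂ then 1 else 0 := by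
  -- rewrite each direction term through Parseval
  have key : ∀ d : Dir, ∀ τ : M.Γ,
      ∑ q : M.Λ, deltaB B i₁ σ₁ q τ d * conj (deltaB B i₂ σ₂ q τ d) =
        ∑ p : M.Λ, ∑ p' : M.Λ, (B.b i₁ : EuclideanSpace ℂ M.Λ) p * conj ((B.b i₂ : EuclideanSpace ℂ M.Λ) p') *
          ⟪M.rvec p' σ₂ τ d, M.rvec p σ₁ τ d⟫_ℂ := by
    intro d τ
    unfold deltaB
    have : ∀ q : M.Λ, (∑ p, (B.b i₁ : EuclideanSpace ℂ M.Λ) p * ⟪(B.b q : EuclideanSpace ℂ M.Λ), M.rvec p σ₁ τ d⟫_ℂ) *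
        conj (∑ p', (B.b i₂ : EuclideanSpace ℂ M.Λ) p' * ⟪(B.b q : EuclideanSpace ℂ M.Λ), M.rvec p' σ₂ τ d⟫_ℂ) =
        ∑ p, ∑ p', (B.b i₁ : EuclideanSpace ℂ M.Λ) p * conj ((B.b i₂ : EuclideanSpace ℂ M.Λ) p') *
          (⟪(B.b q : EuclideanSpace ℂ M.Λ), M.rvec p σ₁ τ d⟫_ℂ * conj ⟪(B.b q : EuclideanSpace ℂ M.Λ), M.rvec p' σ₂ τ d⟫_ℂ) := by
      intro q
      rw [map_sum, Finset.sum_mul_sum]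
      refine Finset.sum_congr rfl fun p _ => Finset.sum_congr rfl fun p' _ => ?_
      rw [map_mul]; ring
    simp_rw [this]
    rw [Finset.sum_comm]
    refine Finset.sum_congr rfl fun p _ => ?_
    rw [Finset.sum_comm]
    refine Finset.sum_congr rfl fun p' _ => ?_
    rw [← Finset.mul_sum, B.sum_inner_mul_conj_inner]
  have hU : ∀ p p' : M.Λ, ∑ τ : M.Γ, (⟪M.rvec p' σ₂ τ Dir.left, M.rvec p σ₁ τ Dir.left⟫_ℂ +
      ⟪M.rvec p' σ₂ τ Dir.right, M.rvec p σ₁ τ Dir.right⟫_ℂ) = M.updateInner p σ₁ p' σ₂ := by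
    intro p p'
    unfold updateInner
    rw [Finset.sum_comm]
    refine Finset.sum_congr rfl fun τ _ => ?_
    rw [PiLp.inner_apply, PiLp.inner_apply, ← Finset.sum_add_distrib]
    refine Finset.sum_congr rfl fun q _ => ?_
    simp only [rvec_apply, RCLike.inner_apply]
  unfold colInner
  simp_rw [phaseAmp_two]
  rw [Finset.sum_comm]
  simp_rw [Finset.sum_add_distrib, key]
  calc (∑ τ, ∑ p, ∑ p', (B.b i₁ : EuclideanSpace ℂ M.Λ) p * conj ((B.b i₂ : EuclideanSpace ℂ M.Λ) p') *
          ⟪M.rvec p' σ₂ τ Dir.left, M.rvec p σ₁ τ Dir.left⟫_ℂ) +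
        ∑ τ, ∑ p, ∑ p', (B.b i₁ : EuclideanSpace ℂ M.Λ) p * conj ((B.b i₂ : EuclideanSpace ℂ M.Λ) p') *
          ⟪M.rvec p' σ₂ τ Dir.right, M.rvec p σ₁ τ Dir.right⟫_ℂ
      = ∑ p, ∑ p', (B.b i₁ : EuclideanSpace ℂ M.Λ) p * conj ((B.b i₂ : EuclideanSpace ℂ M.Λ) p') *
          M.updateInner p σ₁ p' σ₂ := by
        simp_rw [← hU, Finset.mul_sum, mul_add, Finset.sum_add_distrib]
        congr 1
        · rw [Finset.sum_comm]; exact Finset.sum_congr rfl fun p _ => Finset.sum_comm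
        · rw [Finset.sum_comm]; exact Finset.sum_congr rfl fun p _ => Finset.sum_comm
    _ = ∑ p, (B.b i₁ : EuclideanSpace ℂ M.Λ) p * conj ((B.b i₂ : EuclideanSpace ℂ M.Λ) p) * (if σ₁ = σ₂ then 1 else 0) := by
        refine Finset.sum_congr rfl fun p _ => ?_
        simp_rw [updateInner_eq_ite h]
        rw [Finset.sum_eq_single p]
        · by_cases hs : σ₁ = σ₂ <;> simp [hs]
        · intro p' _ hp'; rw [if_neg fun e => hp' e.1.symm, mul_zero]
        · exact fun hp => absurd (Finset.mem_univ p) hp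
    _ = if i₁ = i₂ ∧ σ₁ = σ₂ then 1 else 0 := by
        rw [← Finset.sum_mul, B.sum_mul_conj]
        by_cases hi : i₁ = i₂ <;> by_cases hs : σ₁ = σ₂ <;> simp [hi, hs]

/-- **The column inner products of every phase.** [cite: BernsteinVaziraniSICOMP1997, Lemma 5.5 (proof)] -/
theorem colInner_eq_ite (h : M.IsLocallyWellFormed) (p₁ : M.Λ) (σ₁ : M.Γ) (p₂ : M.Λ) (σ₂ : M.Γ) :
    ∀ k : Fin 5, colInner B k (k + 1) p₁ σ₁ p₂ σ₂ = if p₁ = p₂ ∧ σ₁ = σ₂ then 1 else 0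
  | ⟨0, _⟩ => by
    show colInner B 0 1 p₁ σ₁ p₂ σ₂ = _
    exact colInner_of_detRight B (phaseAmp_zero B) p₁ σ₁ p₂ σ₂
  | ⟨1, _⟩ => by
    show colInner B 1 2 p₁ σ₁ p₂ σ₂ = _
    refine colInner_of_basis B (fun p q => conj ((B.b q : EuclideanSpace ℂ M.Λ) p)) (fun a b => ?_)
      (phaseAmp_one B) p₁ σ₁ p₂ σ₂
    simpa [Complex.conj_conj] using B.sum_conj_mul a b
  | ⟨2, _⟩ => by
    show colInner B 2 3 p₁ σ₁ p₂ σ₂ = _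
    exact colInner_two B h p₁ σ₁ p₂ σ₂
  | ⟨3, _⟩ => by
    show colInner B 3 4 p₁ σ₁ p₂ σ₂ = _
    exact colInner_of_basis B (fun p q => (B.b p : EuclideanSpace ℂ M.Λ) q) (B.sum_mul_conj) (phaseAmp_three B)
      p₁ σ₁ p₂ σ₂
  | ⟨4, _⟩ => by
    show colInner B 4 0 p₁ σ₁ p₂ σ₂ = _
    exact colInner_of_detRight B (phaseAmp_four B) p₁ σ₁ p₂ σ₂
  | ⟨n + 5, hn⟩ => absurd hn (by omega)

/-- The column inner products of `M'`: zero across phases, `colInner` within a phase. [folklore] -/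
theorem updateInner_unidir (k₁ k₂ : Fin 5) (p₁ : M.Λ) (σ₁ : M.Γ) (p₂ : M.Λ) (σ₂ : M.Γ) :
    (M.unidir B).updateInner (p₁, k₁) σ₁ (p₂, k₂) σ₂ = if k₁ = k₂ then colInner B k₁ (k₁ + 1) p₁ σ₁ p₂ σ₂ else 0 := by
  unfold updateInner
  simp only [unidir_δ]
  change ∑ z : M.Λ × Fin 5, ∑ τ : M.Γ, _ = _
  rw [Fintype.sum_prod_type, Finset.sum_comm]
  -- only the phase `k₁ + 1` column survives
  rw [Finset.sum_eq_single (k₁ + 1)]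
  · split_ifs with hk
    · subst hk; rfl
    · refine Finset.sum_eq_zero fun q _ => Finset.sum_eq_zero fun τ _ => ?_
      have hne : k₁ + 1 ≠ k₂ + 1 := fun e => hk (by simpa using e)
      rw [phaseAmp_eq_zero_of_ne B hne, phaseAmp_eq_zero_of_ne B hne]
      simp
  · intro k' _ hk'
    refine Finset.sum_eq_zero fun q _ => Finset.sum_eq_zero fun τ _ => ?_
    rw [phaseAmp_eq_zero_of_ne B hk', phaseAmp_eq_zero_of_ne B hk']
    simp
  · exact fun hh => absurd (Finset.mem_univ _) hh

/-- **`M'` satisfies Bernstein–Vazirani's local well-formedness conditions** (Thm. 5.3): unit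
length and orthogonality phase by phase, separability because the table is unidirectional. [cite: BernsteinVaziraniSICOMP1997, Lemma 5.5 (proof)] -/
theorem unidir_isLocallyWellFormed (h : M.IsLocallyWellFormed) : (M.unidir B).IsLocallyWellFormed where
  unit_length := by
    rintro ⟨p, k⟩ σ
    have h1 := (M.unidir B).updateInner_self (p, k) σ
    rw [updateInner_unidir, if_pos rfl, colInner_eq_ite B h, if_pos ⟨rfl, rfl⟩] at h1
    exact_mod_cast h1.symm
  orthogonality := by
    rintro ⟨p₁, k₁⟩ σ₁ ⟨p₂, k₂⟩ σ₂ hne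
    rw [updateInner_unidir]
    split_ifs with hk
    · subst hk
      rw [colInner_eq_ite B h, if_neg]
      rintro ⟨rfl, rfl⟩
      exact hne rfl
    · rfl
  separability := by
    rintro x σ₁ τ₁ y σ₂ τ₂
    unfold restrictedInner
    refine Finset.sum_eq_zero fun z _ => ?_
    simp only [unidir_δ]
    by_cases hL : phaseAmp B x.2 z.2 x.1 σ₁ z.1 τ₁ Dir.left = 0
    · rw [hL, zero_mul]
    · by_cases hR : phaseAmp B y.2 z.2 y.1 σ₂ z.1 τ₂ Dir.right = 0
      · rw [hR, map_zero, mul_zero]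
      · have e₁ := eq_unidirDir_of_phaseAmp_ne_zero B h hL
        have e₂ := eq_unidirDir_of_phaseAmp_ne_zero B h hR
        rw [← e₁] at e₂
        exact absurd e₂ (by decide)

/-- **`M'` is well formed in Bernstein–Vazirani's sense** (Thm. 5.3, sufficiency). [cite: BernsteinVaziraniSICOMP1997, Lemma 5.5] -/
theorem unidir_pIsWellFormed (h : M.IsLocallyWellFormed) : (M.unidir B).PIsWellFormed :=
  (unidir_isLocallyWellFormed B h).pIsWellFormed

end LocalWF

/-! ### The amplitudes of `M'` are in `C̃` -/

section Amplitudes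

variable (B : M.AdaptedBasis)

/-- If the amplitudes of `M` are in `C̃`, so are the coordinates of its restricted superpositions. [folklore] -/
theorem polyTimeVec_rvec (hamp : M.amplitudes ⊆ polyTimeComputableComplex) (p : M.Λ) (σ τ : M.Γ) (d : Dir) :
    PolyTimeVec (M.rvec p σ τ d) := fun q => hamp ⟨p, σ, q, τ, d, rfl⟩

/-- `deltaB` is in `C̃` when the amplitudes of `M` and the coordinates of `b` are. [cite: BernsteinVaziraniSICOMP1997, Lemma 5.1] -/
theorem deltaB_polyTime (hamp : M.amplitudes ⊆ polyTimeComputableComplex)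
    (hb : ∀ i, PolyTimeVec (B.b i : EuclideanSpace ℂ M.Λ)) (i : M.Λ) (σ : M.Γ) (j : M.Λ) (τ : M.Γ) (d : Dir) :
    IsPolyTimeComputableComplex (deltaB B i σ j τ d) := by
  unfold deltaB
  exact IsPolyTimeComputableComplex.finset_sum _ _ fun p _ =>
    (hb i p).mul ((hb j).inner (polyTimeVec_rvec hamp p σ τ d))

/-- **The amplitudes of `M'` are polynomial-time computable** when those of `M` and the
coordinates of the basis are (Bernstein–Vazirani 1997, Lemma 5.1: "Since the vectors in `B` are
contained in `C̃^Q`, each amplitude of `δ'` is contained in `C̃`"). [cite: BernsteinVaziraniSICOMP1997, Lemma 5.1] -/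
theorem unidir_amplitudes_subset (hamp : M.amplitudes ⊆ polyTimeComputableComplex)
    (hb : ∀ i, PolyTimeVec (B.b i : EuclideanSpace ℂ M.Λ)) :
    (M.unidir B).amplitudes ⊆ polyTimeComputableComplex := by
  rintro z ⟨x, σ, y, τ, d, rfl⟩
  rw [mem_polyTimeComputableComplex_iff, unidir_δ]
  have h0 : IsPolyTimeComputableComplex 0 :=
    ⟨by simpa using isPolyTimeComputableReal_zero, by simpa using isPolyTimeComputableReal_zero⟩
  have h1 : IsPolyTimeComputableComplex 1 :=
    ⟨by simpa using isPolyTimeComputableReal_one, by simpa using isPolyTimeComputableReal_zero⟩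
  unfold phaseAmp
  split_ifs
  · exact h1
  · exact h0
  · exact (hb y.1 x.1).conj
  · exact h0
  · exact deltaB_polyTime B hamp hb _ _ _ _ _
  · exact hb x.1 y.1
  · exact h0
  · exact h1
  · exact h0
  · exact h0

end Amplitudes

/-! ### Linearity of the positioned evolution (for the simulation in the sequel) -/

section Linear

/-- Homogeneity of the positioned evolution on a basis state. [folklore] -/
theorem pevolve_single_smul' (N : QTM) (c : N.PCfg) (a : ℂ) :
    N.pevolve (Finsupp.single c a) = a • N.pevolve (Finsupp.single c 1) := by
  rw [N.pevolve_single_eq_sum, N.pevolve_single_eq_sum, Finset.smul_sum]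
  exact Finset.sum_congr rfl fun u _ => by rw [one_mul, smul_smul]

/-- Additivity of the positioned evolution. [cite: BernsteinVaziraniSICOMP1997, Def. 3.2] -/
theorem pevolve_add' (N : QTM) (ψ φ : N.PCfg →₀ ℂ) : N.pevolve (ψ + φ) = N.pevolve ψ + N.pevolve φ :=
  N.pevolveWith_add N.δ ψ φ

/-- Homogeneity of the positioned evolution. [cite: BernsteinVaziraniSICOMP1997, Def. 3.2] -/
theorem pevolve_smul' (N : QTM) (a : ℂ) (ψ : N.PCfg →₀ ℂ) : N.pevolve (a • ψ) = a • N.pevolve ψ := by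
  induction ψ using Finsupp.induction with
  | zero =>
    rw [smul_zero]
    show N.pevolveWith N.δ 0 = a • N.pevolveWith N.δ 0
    simp [pevolveWith]
  | single_add c b ψ _ _ ih =>
    rw [smul_add, pevolve_add', pevolve_add', smul_add, Finsupp.smul_single, ih, pevolve_single_smul',
      pevolve_single_smul' N c b, smul_smul, smul_eq_mul]

/-- The positioned evolution as a `ℂ`-linear map. [cite: BernsteinVaziraniSICOMP1997, Def. 3.2] -/
def pevolveLin (N : QTM) : (N.PCfg →₀ ℂ) →ₗ[ℂ] (N.PCfg →₀ ℂ) where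
  toFun := N.pevolve
  map_add' := pevolve_add' N
  map_smul' := pevolve_smul' N

/-- `pevolveLin` is `pevolve`. [folklore] -/
@[simp] theorem pevolveLin_apply (N : QTM) (ψ : N.PCfg →₀ ℂ) : N.pevolveLin ψ = N.pevolve ψ := rfl

end Linear

end QTM

end Literature.Computability.Cryptography

end
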